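import Mathlib
import Literature.Combinatorics.Enumerative.TripleRestrictions
import Literature.Combinatorics.Enumerative.PatternAvoidanceDirectSum
import HarnessLib

/-!
# Simion–Schmidt (1985) §5 «Restrictions of higher multiplicity»: Proposition 17 and the cases `|R| = 5, 6`

Permutations of length `n` avoiding four or more patterns of length three, on the tree's notion
`Literature.Combinatorics.Enumerative.PermContainsPattern` (`A_n(R) = Nat.card {v : Perm (Fin n) // v avoids every
τ ∈ R}`, written as conjunctions).  The paper includes these results «for the sake of completeness, without proofs»;
here they are proved, by the elementary «examine every triple» argument: each forbidden pattern forbids one order type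
of the values at any three positions `i < j < k`, which `omega` combines.

* §0 tools: the values form of the six avoidance conditions; increasing permutations are the identity
  (`eq_one_of_strictMono`), the reversal `n ⋯ 2 1 = Fin.revPerm` avoids every non-decreasing pattern.
* §1 «Obviously, `|R| = 6` gives `A_n(R) = 0` for `n ≥ 3`»; `|R| = 5`: «for `n ≥ 4`, the only permutations which avoid
  five 3-letter words are the identity and its reversal.  Thus `A_n(S₃ − {123}) = A_n(S₃ − {321}) = 1`, while
  `A_n(R) = 0` for the other `R`, `|R| = 5`» (the value `1` already for `n ≥ 3`).
* §2 PROPOSITION 17 «If `R ⊂ S₃` and `|R| = 4`, then (a) `A_n(R) = 0` if `R ⊇ {123, 321}` and `n ≥ 5`; (b) `A_n(R) = 2`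
  if `R ⊉ {123, 321}`, `n ≥ 2`», (b) for the three representatives of the nine such `R` under reversal and
  complementation, with the two avoiders named as printed: «the identity, `(2, 3, …, n, 1)`, `(n, …, 3, 1, 2)`»-type —
  here `1` and `Fin.revPerm` for `R = {132, 213, 231, 312}`, `1` and the adjacent transposition `swap (n−2) (n−1)` for
  `R = {213, 231, 312, 321}`, `1` and the rotation `finRotate n = (2, 3, …, n, 1)` for `R = {132, 213, 312, 321}`;
  §3 moves the value `2` to the remaining six `R` along reversal and complementation (all nine cases of (b)).

## References
* [SimionSchmidt1985] R. Simion, F. W. Schmidt, Restricted permutations, European J. Combin. 6 (1985) 383–406, §5,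
  Proposition 17 and the closing remarks (held text `paper:doi-10-1016-s0195-6698-85-80052-4`, p0015).
-/

namespace Literature.Combinatorics.Enumerative

namespace PermContainsPattern

open Finset Equiv

variable {n : ℕ}

/-! ### §0 Tools: avoidance conditions on the values at three positions -/

section Vals

variable {v : Perm (Fin n)} {i j k : Fin n}

/-- `v` avoids `123`: no positions `i < j < k` with `v i < v j < v k` (values in `ℕ`).
[cite: SimionSchmidt1985, §1 (held text p0002)] -/
theorem not123_vals (h : ¬ PermContainsPattern v ![1, 2, 3]) (hij : i < j) (hjk : j < k) :
    ¬ ((v i : ℕ) < v j ∧ (v j : ℕ) < v k) := fun hc =>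
  h ((contains_123_iff v).mpr ⟨i, j, k, hij, hjk, Fin.lt_def.mpr hc.1, Fin.lt_def.mpr hc.2⟩)

/-- `v` avoids `132`: no `i < j < k` with `v i < v k < v j`. [cite: SimionSchmidt1985, §1 (held text p0002)] -/
theorem not132_vals (h : ¬ PermContainsPattern v ![1, 3, 2]) (hij : i < j) (hjk : j < k) :
    ¬ ((v i : ℕ) < v k ∧ (v k : ℕ) < v j) := fun hc =>
  h ((contains_132_iff v).mpr ⟨i, j, k, hij, hjk, Fin.lt_def.mpr hc.1, Fin.lt_def.mpr hc.2⟩)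

/-- `v` avoids `213`: no `i < j < k` with `v j < v i < v k`. [cite: SimionSchmidt1985, §1 (held text p0002)] -/
theorem not213_vals (h : ¬ PermContainsPattern v ![2, 1, 3]) (hij : i < j) (hjk : j < k) :
    ¬ ((v j : ℕ) < v i ∧ (v i : ℕ) < v k) := fun hc =>
  h ((contains_213_iff v).mpr ⟨i, j, k, hij, hjk, Fin.lt_def.mpr hc.1, Fin.lt_def.mpr hc.2⟩)

/-- `v` avoids `231`: no `i < j < k` with `v k < v i < v j`. [cite: SimionSchmidt1985, §1 (held text p0002)] -/
theorem not231_vals (h : ¬ PermContainsPattern v ![2, 3, 1]) (hij : i < j) (hjk : j < k) :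
    ¬ ((v k : ℕ) < v i ∧ (v i : ℕ) < v j) := fun hc =>
  h ((contains_231_iff v).mpr ⟨i, j, k, hij, hjk, Fin.lt_def.mpr hc.1, Fin.lt_def.mpr hc.2⟩)

/-- `v` avoids `312`: no `i < j < k` with `v j < v k < v i`. [cite: SimionSchmidt1985, §1 (held text p0002)] -/
theorem not312_vals (h : ¬ PermContainsPattern v ![3, 1, 2]) (hij : i < j) (hjk : j < k) :
    ¬ ((v j : ℕ) < v k ∧ (v k : ℕ) < v i) := fun hc =>
  h ((contains_312_iff v).mpr ⟨i, j, k, hij, hjk, Fin.lt_def.mpr hc.1, Fin.lt_def.mpr hc.2⟩)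

/-- `v` avoids `321`: no `i < j < k` with `v k < v j < v i`. [cite: SimionSchmidt1985, §1 (held text p0002)] -/
theorem not321_vals (h : ¬ PermContainsPattern v ![3, 2, 1]) (hij : i < j) (hjk : j < k) :
    ¬ ((v k : ℕ) < v j ∧ (v j : ℕ) < v i) := fun hc =>
  h ((contains_321_iff v).mpr ⟨i, j, k, hij, hjk, Fin.lt_def.mpr hc.1, Fin.lt_def.mpr hc.2⟩)

/-- Distinct positions carry distinct values. [folklore] -/
private theorem vals_ne (v : Perm (Fin n)) {i j : Fin n} (h : i ≠ j) : (v i : ℕ) ≠ v j :=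
  fun e => h (v.injective (Fin.ext e))

end Vals

/-! ### §0 Tools: the identity, the reversal -/

section IdRev

/-- An increasing permutation is the identity. [cite: SimionSchmidt1985, §5 (held text p0015)] -/
theorem eq_one_of_strictMono {v : Perm (Fin n)} (h : StrictMono v) : v = 1 := by
  have ha : StrictAnti ⇑(v * Fin.revPerm : Perm (Fin n)) := fun a b hab => by
    simp only [Perm.coe_mul, Function.comp_apply, Fin.revPerm_apply]
    exact h (Fin.rev_lt_rev.mpr hab)
  have e := eq_revPerm_of_strictAnti ha
  have : v * Fin.revPerm = 1 * Fin.revPerm := by rw [e, one_mul]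
  exact mul_right_cancel this

/-- The reversal `n ⋯ 2 1` is not the identity once `n ≥ 2`. [cite: SimionSchmidt1985, §5 (held text p0015)] -/
theorem revPerm_ne_one (hn : 2 ≤ n) : (Fin.revPerm : Perm (Fin n)) ≠ 1 := by
  intro h
  have := congrArg (fun w : Perm (Fin n) => ((w ⟨0, by omega⟩ : Fin n) : ℕ)) h
  simp only [Fin.revPerm_apply, Fin.val_rev, Perm.coe_one, id_eq] at this
  omega

/-- The reversal avoids every pattern that is not decreasing (dual of `not_contains_one_of_not_strictMono`).
[cite: SimionSchmidt1985, Lemma 1 (held text p0002)] -/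
theorem not_contains_revPerm_of_not_strictAnti {k : ℕ} {q : Fin k → ℕ} (hq : ¬ StrictAnti q) (n : ℕ) :
    ¬ PermContainsPattern (Fin.revPerm : Perm (Fin n)) q := by
  intro h
  have h' : PermContainsPattern ((1 : Perm (Fin n)) * Fin.revPerm) q := by rwa [one_mul]
  rw [reverse_iff] at h'
  refine not_contains_one_of_not_strictMono (q := q ∘ Fin.rev) (fun hm => hq fun a b hab => ?_) n h'
  simpa only [Function.comp_apply, Fin.rev_rev] using hm (Fin.rev_lt_rev.mpr hab)

/-- Three distinct positions exist once `n ≥ 3`: some `k ∉ {i, j}`. [folklore] -/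
private theorem exists_ne_ne (hn : 3 ≤ n) (i j : Fin n) : ∃ k : Fin n, k ≠ i ∧ k ≠ j := by
  by_contra hno
  push Not at hno
  have hsub : (Finset.univ : Finset (Fin n)) ⊆ {i, j} := fun k _ => by
    rw [Finset.mem_insert, Finset.mem_singleton]
    by_contra hk
    push Not at hk
    exact hk.2 (hno k hk.1)
  have := Finset.card_le_card hsub
  rw [Finset.card_univ, Fintype.card_fin] at this
  have := Finset.card_insert_le i ({j} : Finset (Fin n))
  rw [Finset.card_singleton] at this
  omega

end IdRev

/-! ### §1 Six and five restrictions -/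

section FiveSix

/-- «Obviously, `|R| = 6` gives `A_n(R) = 0` for `n ≥ 3`»: three positions always carry one of the six patterns.
[cite: SimionSchmidt1985, §5 (held text p0015)] -/
theorem card_av_all_six_eq_zero (hn : 3 ≤ n) :
    Nat.card {v : Perm (Fin n) // ¬ PermContainsPattern v ![1, 2, 3] ∧ ¬ PermContainsPattern v ![1, 3, 2] ∧
      ¬ PermContainsPattern v ![2, 1, 3] ∧ ¬ PermContainsPattern v ![2, 3, 1] ∧ ¬ PermContainsPattern v ![3, 1, 2] ∧
        ¬ PermContainsPattern v ![3, 2, 1]} = 0 := by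
  rw [Nat.card_eq_zero]
  refine Or.inl ⟨fun ⟨v, h1, h2, h3, h4, h5, h6⟩ => ?_⟩
  have hij : (⟨0, by omega⟩ : Fin n) < ⟨1, by omega⟩ := Fin.mk_lt_mk.mpr (by norm_num)
  have hjk : (⟨1, by omega⟩ : Fin n) < ⟨2, by omega⟩ := Fin.mk_lt_mk.mpr (by norm_num)
  have := not123_vals h1 hij hjk
  have := not132_vals h2 hij hjk
  have := not213_vals h3 hij hjk
  have := not231_vals h4 hij hjk
  have := not312_vals h5 hij hjk
  have := not321_vals h6 hij hjk
  have := vals_ne v hij.ne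
  have := vals_ne v hjk.ne
  have := vals_ne v (hij.trans hjk).ne
  omega

/-- «The only permutation which avoids the five 3-letter words other than `123` is the identity» (`n ≥ 3`): an avoider
of `132, 213, 231, 312, 321` increases. [cite: SimionSchmidt1985, §5 (held text p0015)] -/
theorem strictMono_of_av_five (hn : 3 ≤ n) {v : Perm (Fin n)} (h2 : ¬ PermContainsPattern v ![1, 3, 2])
    (h3 : ¬ PermContainsPattern v ![2, 1, 3]) (h4 : ¬ PermContainsPattern v ![2, 3, 1])
    (h5 : ¬ PermContainsPattern v ![3, 1, 2]) (h6 : ¬ PermContainsPattern v ![3, 2, 1]) : StrictMono v := by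
  intro i j hij
  rw [Fin.lt_def]
  have hne := vals_ne v hij.ne
  by_contra hle
  obtain ⟨k, hki, hkj⟩ := exists_ne_ne hn i j
  rcases lt_or_gt_of_ne hki with hk | hk
  · -- `k < i < j`
    have := not132_vals h2 hk hij
    have := not231_vals h4 hk hij
    have := not321_vals h6 hk hij
    have := vals_ne v hki
    have := vals_ne v hkj
    omega
  · rcases lt_or_gt_of_ne hkj with hk' | hk'
    · -- `i < k < j`
      have := not231_vals h4 hk hk'
      have := not312_vals h5 hk hk'
      have := not321_vals h6 hk hk'
      have := vals_ne v hki
      have := vals_ne v hkj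
      omega
    · -- `i < j < k`
      have := not213_vals h3 hij hk'
      have := not312_vals h5 hij hk'
      have := not321_vals h6 hij hk'
      have := vals_ne v hki
      have := vals_ne v hkj
      omega

/-- Dually, an avoider of `123, 132, 213, 231, 312` decreases (`n ≥ 3`). [cite: SimionSchmidt1985, §5 (held text p0015)] -/
theorem strictAnti_of_av_five (hn : 3 ≤ n) {v : Perm (Fin n)} (h1 : ¬ PermContainsPattern v ![1, 2, 3])
    (h2 : ¬ PermContainsPattern v ![1, 3, 2]) (h3 : ¬ PermContainsPattern v ![2, 1, 3])
    (h4 : ¬ PermContainsPattern v ![2, 3, 1]) (h5 : ¬ PermContainsPattern v ![3, 1, 2]) : StrictAnti v := by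
  intro i j hij
  rw [Fin.lt_def]
  have hne := vals_ne v hij.ne
  by_contra hle
  obtain ⟨k, hki, hkj⟩ := exists_ne_ne hn i j
  rcases lt_or_gt_of_ne hki with hk | hk
  · have := not123_vals h1 hk hij
    have := not213_vals h3 hk hij
    have := not312_vals h5 hk hij
    have := vals_ne v hki
    have := vals_ne v hkj
    omega
  · rcases lt_or_gt_of_ne hkj with hk' | hk'
    · have := not123_vals h1 hk hk'
      have := not132_vals h2 hk hk'
      have := not213_vals h3 hk hk'
      have := vals_ne v hki
      have := vals_ne v hkj
      omega
    · have := not123_vals h1 hij hk'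
      have := not132_vals h2 hij hk'
      have := not231_vals h4 hij hk'
      have := vals_ne v hki
      have := vals_ne v hkj
      omega

/-- ★ «`A_n(S₃ − {123}) = 1`» (`n ≥ 3`; the only avoider is the identity). [cite: SimionSchmidt1985, §5 (held text p0015)] -/
theorem card_av_all_but_123 (hn : 3 ≤ n) :
    Nat.card {v : Perm (Fin n) // ¬ PermContainsPattern v ![1, 3, 2] ∧ ¬ PermContainsPattern v ![2, 1, 3] ∧
      ¬ PermContainsPattern v ![2, 3, 1] ∧ ¬ PermContainsPattern v ![3, 1, 2] ∧ ¬ PermContainsPattern v ![3, 2, 1]} = 1 := by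
  rw [Nat.card_eq_one_iff_unique]
  refine ⟨⟨fun ⟨v, hv⟩ ⟨w, hw⟩ => Subtype.ext ?_⟩, ⟨⟨1, ?_⟩⟩⟩
  · change v = w
    rw [eq_one_of_strictMono (strictMono_of_av_five hn hv.1 hv.2.1 hv.2.2.1 hv.2.2.2.1 hv.2.2.2.2),
      eq_one_of_strictMono (strictMono_of_av_five hn hw.1 hw.2.1 hw.2.2.1 hw.2.2.2.1 hw.2.2.2.2)]
  · exact ⟨not_contains_one_of_not_strictMono (by decide) n, not_contains_one_of_not_strictMono (by decide) n,
      not_contains_one_of_not_strictMono (by decide) n, not_contains_one_of_not_strictMono (by decide) n,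
      not_contains_one_of_not_strictMono (by decide) n⟩

/-- ★ «`A_n(S₃ − {321}) = 1`» (`n ≥ 3`; the only avoider is the reversal). [cite: SimionSchmidt1985, §5 (held text p0015)] -/
theorem card_av_all_but_321 (hn : 3 ≤ n) :
    Nat.card {v : Perm (Fin n) // ¬ PermContainsPattern v ![1, 2, 3] ∧ ¬ PermContainsPattern v ![1, 3, 2] ∧
      ¬ PermContainsPattern v ![2, 1, 3] ∧ ¬ PermContainsPattern v ![2, 3, 1] ∧ ¬ PermContainsPattern v ![3, 1, 2]} = 1 := by
  rw [Nat.card_eq_one_iff_unique]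
  refine ⟨⟨fun ⟨v, hv⟩ ⟨w, hw⟩ => Subtype.ext ?_⟩, ⟨⟨Fin.revPerm, ?_⟩⟩⟩
  · change v = w
    rw [eq_revPerm_of_strictAnti (strictAnti_of_av_five hn hv.1 hv.2.1 hv.2.2.1 hv.2.2.2.1 hv.2.2.2.2),
      eq_revPerm_of_strictAnti (strictAnti_of_av_five hn hw.1 hw.2.1 hw.2.2.1 hw.2.2.2.1 hw.2.2.2.2)]
  · exact ⟨not_contains_revPerm_of_not_strictAnti (by decide) n, not_contains_revPerm_of_not_strictAnti (by decide) n,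
      not_contains_revPerm_of_not_strictAnti (by decide) n, not_contains_revPerm_of_not_strictAnti (by decide) n,
      not_contains_revPerm_of_not_strictAnti (by decide) n⟩

/-- «`A_n(R) = 0` for the other `R`, `|R| = 5`», `R = S₃ − {132}`, `n ≥ 4`: the triples at positions `0 1 2` and
`1 2 3` cannot both be of type `132`. [cite: SimionSchmidt1985, §5 (held text p0015)] -/
theorem card_av_all_but_132_eq_zero (hn : 4 ≤ n) :
    Nat.card {v : Perm (Fin n) // ¬ PermContainsPattern v ![1, 2, 3] ∧ ¬ PermContainsPattern v ![2, 1, 3] ∧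
      ¬ PermContainsPattern v ![2, 3, 1] ∧ ¬ PermContainsPattern v ![3, 1, 2] ∧ ¬ PermContainsPattern v ![3, 2, 1]} = 0 := by
  rw [Nat.card_eq_zero]
  refine Or.inl ⟨fun ⟨v, h1, h3, h4, h5, h6⟩ => ?_⟩
  have h01 : (⟨0, by omega⟩ : Fin n) < ⟨1, by omega⟩ := Fin.mk_lt_mk.mpr (by norm_num)
  have h12 : (⟨1, by omega⟩ : Fin n) < ⟨2, by omega⟩ := Fin.mk_lt_mk.mpr (by norm_num)
  have h23 : (⟨2, by omega⟩ : Fin n) < ⟨3, by omega⟩ := Fin.mk_lt_mk.mpr (by norm_num)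
  have := not123_vals h1 h01 h12
  have := not213_vals h3 h01 h12
  have := not231_vals h4 h01 h12
  have := not312_vals h5 h01 h12
  have := not321_vals h6 h01 h12
  have := not123_vals h1 h12 h23
  have := not213_vals h3 h12 h23
  have := not231_vals h4 h12 h23
  have := not312_vals h5 h12 h23
  have := not321_vals h6 h12 h23
  have := vals_ne v h01.ne
  have := vals_ne v h12.ne
  have := vals_ne v h23.ne
  have := vals_ne v (h01.trans h12).ne
  have := vals_ne v (h12.trans h23).ne
  omega

/-- `R = S₃ − {213}`, `n ≥ 4`: `A_n(R) = 0`. [cite: SimionSchmidt1985, §5 (held text p0015)] -/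
theorem card_av_all_but_213_eq_zero (hn : 4 ≤ n) :
    Nat.card {v : Perm (Fin n) // ¬ PermContainsPattern v ![1, 2, 3] ∧ ¬ PermContainsPattern v ![1, 3, 2] ∧
      ¬ PermContainsPattern v ![2, 3, 1] ∧ ¬ PermContainsPattern v ![3, 1, 2] ∧ ¬ PermContainsPattern v ![3, 2, 1]} = 0 := by
  rw [Nat.card_eq_zero]
  refine Or.inl ⟨fun ⟨v, h1, h2, h4, h5, h6⟩ => ?_⟩
  have h01 : (⟨0, by omega⟩ : Fin n) < ⟨1, by omega⟩ := Fin.mk_lt_mk.mpr (by norm_num)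
  have h12 : (⟨1, by omega⟩ : Fin n) < ⟨2, by omega⟩ := Fin.mk_lt_mk.mpr (by norm_num)
  have h23 : (⟨2, by omega⟩ : Fin n) < ⟨3, by omega⟩ := Fin.mk_lt_mk.mpr (by norm_num)
  have := not123_vals h1 h01 h12
  have := not132_vals h2 h01 h12
  have := not231_vals h4 h01 h12
  have := not312_vals h5 h01 h12
  have := not321_vals h6 h01 h12
  have := not123_vals h1 h12 h23
  have := not132_vals h2 h12 h23
  have := not231_vals h4 h12 h23
  have := not312_vals h5 h12 h23
  have := not321_vals h6 h12 h23
  have := vals_ne v h01.ne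
  have := vals_ne v h12.ne
  have := vals_ne v h23.ne
  have := vals_ne v (h01.trans h12).ne
  have := vals_ne v (h12.trans h23).ne
  omega

/-- `R = S₃ − {231}`, `n ≥ 4`: `A_n(R) = 0`. [cite: SimionSchmidt1985, §5 (held text p0015)] -/
theorem card_av_all_but_231_eq_zero (hn : 4 ≤ n) :
    Nat.card {v : Perm (Fin n) // ¬ PermContainsPattern v ![1, 2, 3] ∧ ¬ PermContainsPattern v ![1, 3, 2] ∧
      ¬ PermContainsPattern v ![2, 1, 3] ∧ ¬ PermContainsPattern v ![3, 1, 2] ∧ ¬ PermContainsPattern v ![3, 2, 1]} = 0 := by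
  rw [Nat.card_eq_zero]
  refine Or.inl ⟨fun ⟨v, h1, h2, h3, h5, h6⟩ => ?_⟩
  have h01 : (⟨0, by omega⟩ : Fin n) < ⟨1, by omega⟩ := Fin.mk_lt_mk.mpr (by norm_num)
  have h12 : (⟨1, by omega⟩ : Fin n) < ⟨2, by omega⟩ := Fin.mk_lt_mk.mpr (by norm_num)
  have h23 : (⟨2, by omega⟩ : Fin n) < ⟨3, by omega⟩ := Fin.mk_lt_mk.mpr (by norm_num)
  have := not123_vals h1 h01 h12
  have := not132_vals h2 h01 h12
  have := not213_vals h3 h01 h12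
  have := not312_vals h5 h01 h12
  have := not321_vals h6 h01 h12
  have := not123_vals h1 h12 h23
  have := not132_vals h2 h12 h23
  have := not213_vals h3 h12 h23
  have := not312_vals h5 h12 h23
  have := not321_vals h6 h12 h23
  have := vals_ne v h01.ne
  have := vals_ne v h12.ne
  have := vals_ne v h23.ne
  have := vals_ne v (h01.trans h12).ne
  have := vals_ne v (h12.trans h23).ne
  omega

/-- `R = S₃ − {312}`, `n ≥ 4`: `A_n(R) = 0`. [cite: SimionSchmidt1985, §5 (held text p0015)] -/
theorem card_av_all_but_312_eq_zero (hn : 4 ≤ n) :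
    Nat.card {v : Perm (Fin n) // ¬ PermContainsPattern v ![1, 2, 3] ∧ ¬ PermContainsPattern v ![1, 3, 2] ∧
      ¬ PermContainsPattern v ![2, 1, 3] ∧ ¬ PermContainsPattern v ![2, 3, 1] ∧ ¬ PermContainsPattern v ![3, 2, 1]} = 0 := by
  rw [Nat.card_eq_zero]
  refine Or.inl ⟨fun ⟨v, h1, h2, h3, h4, h6⟩ => ?_⟩
  have h01 : (⟨0, by omega⟩ : Fin n) < ⟨1, by omega⟩ := Fin.mk_lt_mk.mpr (by norm_num)
  have h12 : (⟨1, by omega⟩ : Fin n) < ⟨2, by omega⟩ := Fin.mk_lt_mk.mpr (by norm_num)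
  have h23 : (⟨2, by omega⟩ : Fin n) < ⟨3, by omega⟩ := Fin.mk_lt_mk.mpr (by norm_num)
  have := not123_vals h1 h01 h12
  have := not132_vals h2 h01 h12
  have := not213_vals h3 h01 h12
  have := not231_vals h4 h01 h12
  have := not321_vals h6 h01 h12
  have := not123_vals h1 h12 h23
  have := not132_vals h2 h12 h23
  have := not213_vals h3 h12 h23
  have := not231_vals h4 h12 h23
  have := not321_vals h6 h12 h23
  have := vals_ne v h01.ne
  have := vals_ne v h12.ne
  have := vals_ne v h23.ne
  have := vals_ne v (h01.trans h12).ne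
  have := vals_ne v (h12.trans h23).ne
  omega

end FiveSix

/-! ### §2 PROPOSITION 17 — four restrictions -/

section Prop17

/-- PROPOSITION 17 (a) «`A_n(R) = 0` if `R ⊇ {123, 321}` and `n ≥ 5`» — for any further restrictions `Q`.
[cite: SimionSchmidt1985, Proposition 17 (a) (held text p0015)] -/
theorem card_av123_av321_and_eq_zero (Q : Perm (Fin n) → Prop) (hn : 5 ≤ n) :
    Nat.card {v : Perm (Fin n) // ¬ PermContainsPattern v ![1, 2, 3] ∧ ¬ PermContainsPattern v ![3, 2, 1] ∧ Q v} = 0 := by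
  rw [Nat.card_eq_zero]
  refine Or.inl ⟨fun ⟨v, h1, h2, _⟩ => ?_⟩
  rcases contains_123_or_321_of_five_le hn v with h | h
  · exact h1 h
  · exact h2 h

/-- A subtype with exactly the two elements `x ≠ y` has `Nat.card = 2`. [folklore] -/
private theorem natCard_eq_two {α : Type*} {P : α → Prop} (x y : α) (hx : P x) (hy : P y) (hxy : x ≠ y)
    (h : ∀ z, P z → z = x ∨ z = y) : Nat.card {z : α // P z} = 2 := by
  rw [Nat.card_eq_two_iff]
  refine ⟨⟨x, hx⟩, ⟨y, hy⟩, fun e => hxy (congrArg Subtype.val e), Set.eq_univ_iff_forall.mpr fun z => ?_⟩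
  rcases h z.1 z.2 with e | e
  · exact Or.inl (Subtype.ext e)
  · exact Or.inr (Subtype.ext e)

/-- `R = {132, 213, 231, 312}` (every triple monotone): an avoider is the identity or the reversal (`n ≥ 2`).
[cite: SimionSchmidt1985, Proposition 17 (b) and the remark after it (held text p0015)] -/
theorem eq_one_or_eq_revPerm_of_av_four (hn : 2 ≤ n) {v : Perm (Fin n)} (h2 : ¬ PermContainsPattern v ![1, 3, 2])
    (h3 : ¬ PermContainsPattern v ![2, 1, 3]) (h4 : ¬ PermContainsPattern v ![2, 3, 1])
    (h5 : ¬ PermContainsPattern v ![3, 1, 2]) : v = 1 ∨ v = Fin.revPerm := by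
  set a : Fin n := ⟨0, by omega⟩ with ha
  set b : Fin n := ⟨1, by omega⟩ with hb
  have hab : a < b := Fin.mk_lt_mk.mpr (by norm_num)
  -- every triple `i < j < k` is monotone
  have mono : ∀ i j k : Fin n, i < j → j < k → ((v i : ℕ) < v j ↔ (v j : ℕ) < v k) := fun i j k hij hjk => by
    have := not132_vals h2 hij hjk
    have := not213_vals h3 hij hjk
    have := not231_vals h4 hij hjk
    have := not312_vals h5 hij hjk
    have := vals_ne v hij.ne
    have := vals_ne v hjk.ne
    have := vals_ne v (hij.trans hjk).ne
    omega
  rcases lt_or_gt_of_ne (vals_ne v hab.ne) with hlt | hlt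
  · left
    refine eq_one_of_strictMono fun i j hij => Fin.lt_def.mpr ?_
    have hi : (i : ℕ) = 0 ∨ (i : ℕ) = 1 ∨ 1 < (i : ℕ) := by omega
    rcases hi with hi | hi | hi
    · have hia : i = a := Fin.ext hi
      rw [hia] at hij ⊢
      by_cases hjb : j = b
      · rwa [hjb]
      · have hbj : b < j := by
          rw [Fin.lt_def] at hij ⊢
          have : (j : ℕ) ≠ 1 := fun e => hjb (Fin.ext e)
          simp only [hb] at this ⊢
          simp only [ha] at hij
          omega
        have := (mono a b j hab hbj).mp hlt
        omega
    · have hib : i = b := Fin.ext hi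
      rw [hib] at hij ⊢
      exact (mono a b j hab hij).mp hlt
    · have hbi : b < i := Fin.lt_def.mpr (by simpa [hb] using hi)
      have h1 := (mono a b i hab hbi).mp hlt
      exact (mono a i j (hab.trans hbi) hij).mp (hlt.trans h1)
  · right
    refine eq_revPerm_of_strictAnti fun i j hij => Fin.lt_def.mpr ?_
    have hi : (i : ℕ) = 0 ∨ (i : ℕ) = 1 ∨ 1 < (i : ℕ) := by omega
    rcases hi with hi | hi | hi
    · have hia : i = a := Fin.ext hi
      rw [hia] at hij ⊢
      by_cases hjb : j = b
      · rwa [hjb]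
      · have hbj : b < j := by
          rw [Fin.lt_def] at hij ⊢
          have : (j : ℕ) ≠ 1 := fun e => hjb (Fin.ext e)
          simp only [hb] at this ⊢
          simp only [ha] at hij
          omega
        have := (mono a b j hab hbj).not.mp (by omega)
        have := vals_ne v hbj.ne
        omega
    · have hib : i = b := Fin.ext hi
      rw [hib] at hij ⊢
      have := (mono a b j hab hij).not.mp (by omega)
      have := vals_ne v hij.ne
      omega
    · have hbi : b < i := Fin.lt_def.mpr (by simpa [hb] using hi)
      have h1 := (mono a b i hab hbi).not.mp (by omega)
      have := vals_ne v hbi.ne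
      have h2 := (mono a i j (hab.trans hbi) hij).not.mp (by omega)
      have := vals_ne v hij.ne
      omega

/-- ★★ PROPOSITION 17 (b) for `R = {132, 213, 231, 312}` (omitted pair `{123, 321}`): `A_n(R) = 2` for `n ≥ 2`, the
avoiders being the identity and its reversal. [cite: SimionSchmidt1985, Proposition 17 (b) (held text p0015)] -/
theorem card_av132_av213_av231_av312 (hn : 2 ≤ n) :
    Nat.card {v : Perm (Fin n) // ¬ PermContainsPattern v ![1, 3, 2] ∧ ¬ PermContainsPattern v ![2, 1, 3] ∧
      ¬ PermContainsPattern v ![2, 3, 1] ∧ ¬ PermContainsPattern v ![3, 1, 2]} = 2 := by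
  refine natCard_eq_two 1 Fin.revPerm
    ⟨not_contains_one_of_not_strictMono (by decide) n, not_contains_one_of_not_strictMono (by decide) n,
      not_contains_one_of_not_strictMono (by decide) n, not_contains_one_of_not_strictMono (by decide) n⟩
    ⟨not_contains_revPerm_of_not_strictAnti (by decide) n, not_contains_revPerm_of_not_strictAnti (by decide) n,
      not_contains_revPerm_of_not_strictAnti (by decide) n, not_contains_revPerm_of_not_strictAnti (by decide) n⟩
    (revPerm_ne_one hn).symm fun v hv => eq_one_or_eq_revPerm_of_av_four hn hv.1 hv.2.1 hv.2.2.1 hv.2.2.2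

/-- The values of a transposition. [folklore] -/
private theorem swap_val (c d x : Fin n) :
    ((Equiv.swap c d x : Fin n) : ℕ) = if x = c then (d : ℕ) else if x = d then (c : ℕ) else (x : ℕ) := by
  rw [Equiv.swap_apply_def]
  split_ifs <;> rfl

/-- `R = {213, 231, 312, 321}` (every triple of type `123` or `132`): an avoider is the identity or the adjacent
transposition of the last two letters `(1, …, n−2, n, n−1)` (`n ≥ 2`). [cite: SimionSchmidt1985, Proposition 17 (b)
and the remark after it (held text p0015)] -/
theorem eq_one_or_eq_swap_of_av_four (hn : 2 ≤ n) {v : Perm (Fin n)} (h3 : ¬ PermContainsPattern v ![2, 1, 3])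
    (h4 : ¬ PermContainsPattern v ![2, 3, 1]) (h5 : ¬ PermContainsPattern v ![3, 1, 2])
    (h6 : ¬ PermContainsPattern v ![3, 2, 1]) :
    v = 1 ∨ v = Equiv.swap (⟨n - 2, by omega⟩ : Fin n) ⟨n - 1, by omega⟩ := by
  set c : Fin n := ⟨n - 2, by omega⟩ with hc
  set d : Fin n := ⟨n - 1, by omega⟩ with hd
  -- a descent `x y` is forced to be `c d`
  have hdesc : ∀ x y : Fin n, x < y → (v y : ℕ) < v x → (x : ℕ) = n - 2 ∧ (y : ℕ) = n - 1 := by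
    intro x y hxy hyx
    have hy : (y : ℕ) = n - 1 := by
      by_contra hne
      have hyd : y < d := Fin.lt_def.mpr (by simp only [hd]; omega)
      have := not213_vals h3 hxy hyd
      have := not312_vals h5 hxy hyd
      have := not321_vals h6 hxy hyd
      have := vals_ne v hyd.ne
      have := vals_ne v (hxy.trans hyd).ne
      omega
    refine ⟨?_, hy⟩
    by_contra hne
    have hlt : (x : ℕ) + 1 < y := by rw [Fin.lt_def] at hxy; omega
    set z : Fin n := ⟨x + 1, by omega⟩ with hz
    have hxz : x < z := Fin.lt_def.mpr (by simp [hz])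
    have hzy : z < y := Fin.lt_def.mpr (by simpa [hz] using hlt)
    have := not231_vals h4 hxz hzy
    have := not312_vals h5 hxz hzy
    have := not321_vals h6 hxz hzy
    have := vals_ne v hxz.ne
    have := vals_ne v hzy.ne
    omega
  by_cases hm : StrictMono v
  · exact Or.inl (eq_one_of_strictMono hm)
  right
  -- there is a descent, hence at `c d`, and all other pairs ascend
  obtain ⟨x, y, hxy, hyx⟩ : ∃ x y : Fin n, x < y ∧ (v y : ℕ) < v x := by
    simp only [StrictMono, not_forall] at hm
    obtain ⟨x, y, hxy, h⟩ := hm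
    refine ⟨x, y, hxy, ?_⟩
    have := vals_ne v hxy.ne
    rw [Fin.lt_def, not_lt] at h
    omega
  obtain ⟨hx, hy⟩ := hdesc x y hxy hyx
  have hxc : x = c := Fin.ext (by simpa [hc] using hx)
  have hyd : y = d := Fin.ext (by simpa [hd] using hy)
  rw [hxc, hyd] at hyx
  have hasc : ∀ s t : Fin n, s < t → ¬ (s = c ∧ t = d) → (v s : ℕ) < v t := by
    intro s t hst hne
    have := vals_ne v hst.ne
    by_contra hle
    obtain ⟨hs, ht⟩ := hdesc s t hst (by omega)
    exact hne ⟨Fin.ext (by simpa [hc] using hs), Fin.ext (by simpa [hd] using ht)⟩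
  have hcv : (c : ℕ) = n - 2 := rfl
  have hdv : (d : ℕ) = n - 1 := rfl
  have key : StrictMono ⇑(v * Equiv.swap c d : Perm (Fin n)) := by
    intro s t hst
    rw [Fin.lt_def]
    simp only [Perm.coe_mul, Function.comp_apply]
    have hst' : (s : ℕ) < t := Fin.lt_def.mp hst
    have ht_lt : (t : ℕ) < n := t.2
    have hsd : s ≠ d := fun e => by rw [e] at hst'; omega
    by_cases htd : t = d
    · rw [htd, Equiv.swap_apply_right]
      by_cases hsc : s = c
      · rw [hsc, Equiv.swap_apply_left]
        exact hyx
      · rw [Equiv.swap_apply_of_ne_of_ne hsc hsd]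
        have hsc' : (s : ℕ) ≠ n - 2 := fun e => hsc (Fin.ext (by rw [hcv]; exact e))
        rw [htd] at hst'
        exact hasc s c (Fin.lt_def.mpr (by omega)) (fun h => hsc h.1)
    · have htd' : (t : ℕ) ≠ n - 1 := fun e => htd (Fin.ext (by rw [hdv]; exact e))
      have hsc : s ≠ c := fun e => by rw [e] at hst'; omega
      rw [Equiv.swap_apply_of_ne_of_ne hsc hsd]
      by_cases htc : t = c
      · rw [htc, Equiv.swap_apply_left]
        exact hasc s d (Fin.lt_def.mpr (by omega)) (fun h => hsc h.1)
      · rw [Equiv.swap_apply_of_ne_of_ne htc htd]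
        exact hasc s t hst (fun h => hsc h.1)
  have := eq_one_of_strictMono key
  rw [mul_eq_one_iff_eq_inv, Equiv.swap_inv] at this
  exact this

/-- The adjacent transposition of the last two letters avoids `213, 231, 312, 321` (all its triples are `123` or `132`).
[cite: SimionSchmidt1985, Proposition 17 (b), remark (held text p0015)] -/
theorem swap_last_av_four (hn : 2 ≤ n) :
    ¬ PermContainsPattern (Equiv.swap (⟨n - 2, by omega⟩ : Fin n) ⟨n - 1, by omega⟩) ![2, 1, 3] ∧
      ¬ PermContainsPattern (Equiv.swap (⟨n - 2, by omega⟩ : Fin n) ⟨n - 1, by omega⟩) ![2, 3, 1] ∧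
      ¬ PermContainsPattern (Equiv.swap (⟨n - 2, by omega⟩ : Fin n) ⟨n - 1, by omega⟩) ![3, 1, 2] ∧
      ¬ PermContainsPattern (Equiv.swap (⟨n - 2, by omega⟩ : Fin n) ⟨n - 1, by omega⟩) ![3, 2, 1] := by
  refine ⟨fun h => ?_, fun h => ?_, fun h => ?_, fun h => ?_⟩
  · obtain ⟨i, j, k, hij, hjk, h1, h2⟩ := (contains_213_iff _).mp h
    rw [Fin.lt_def] at hij hjk h1 h2
    simp only [swap_val, Fin.ext_iff] at h1 h2
    have := k.2
    split_ifs at h1 h2 <;> omega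
  · obtain ⟨i, j, k, hij, hjk, h1, h2⟩ := (contains_231_iff _).mp h
    rw [Fin.lt_def] at hij hjk h1 h2
    simp only [swap_val, Fin.ext_iff] at h1 h2
    have := k.2
    split_ifs at h1 h2 <;> omega
  · obtain ⟨i, j, k, hij, hjk, h1, h2⟩ := (contains_312_iff _).mp h
    rw [Fin.lt_def] at hij hjk h1 h2
    simp only [swap_val, Fin.ext_iff] at h1 h2
    have := k.2
    split_ifs at h1 h2 <;> omega
  · obtain ⟨i, j, k, hij, hjk, h1, h2⟩ := (contains_321_iff _).mp h
    rw [Fin.lt_def] at hij hjk h1 h2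
    simp only [swap_val, Fin.ext_iff] at h1 h2
    have := k.2
    split_ifs at h1 h2 <;> omega

/-- ★★ PROPOSITION 17 (b) for `R = {213, 231, 312, 321}` (omitted pair `{123, 132}`): `A_n(R) = 2` for `n ≥ 2`.
[cite: SimionSchmidt1985, Proposition 17 (b) (held text p0015)] -/
theorem card_av213_av231_av312_av321 (hn : 2 ≤ n) :
    Nat.card {v : Perm (Fin n) // ¬ PermContainsPattern v ![2, 1, 3] ∧ ¬ PermContainsPattern v ![2, 3, 1] ∧
      ¬ PermContainsPattern v ![3, 1, 2] ∧ ¬ PermContainsPattern v ![3, 2, 1]} = 2 := by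
  refine natCard_eq_two 1 (Equiv.swap (⟨n - 2, by omega⟩ : Fin n) ⟨n - 1, by omega⟩)
    ⟨not_contains_one_of_not_strictMono (by decide) n, not_contains_one_of_not_strictMono (by decide) n,
      not_contains_one_of_not_strictMono (by decide) n, not_contains_one_of_not_strictMono (by decide) n⟩
    (swap_last_av_four hn) (fun h => ?_) fun v hv => eq_one_or_eq_swap_of_av_four hn hv.1 hv.2.1 hv.2.2.1 hv.2.2.2
  have := congrArg (fun w : Perm (Fin n) => ((w ⟨n - 2, by omega⟩ : Fin n) : ℕ)) h
  simp only [Perm.coe_one, id_eq, Equiv.swap_apply_left] at this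
  omega

/-- The values of the rotation `(2, 3, …, n, 1)`: `i ↦ i + 1`, last `↦ 0`. [folklore] -/
private theorem finRotate_val {m : ℕ} (x : Fin (m + 1)) :
    ((finRotate (m + 1) x : Fin (m + 1)) : ℕ) = if (x : ℕ) = m then 0 else (x : ℕ) + 1 := by
  rw [coe_finRotate]
  simp only [Fin.ext_iff, Fin.val_last]

/-- `R = {132, 213, 312, 321}` (every triple of type `123` or `231`): an avoider is the identity or the rotation
`(2, 3, …, n, 1) = finRotate n`, whose last letter is the smallest (`n = m + 1 ≥ 2`).
[cite: SimionSchmidt1985, Proposition 17 (b) and the remark after it (held text p0015)] -/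
theorem eq_one_or_eq_finRotate_of_av_four {m : ℕ} {v : Perm (Fin (m + 1))}
    (h2 : ¬ PermContainsPattern v ![1, 3, 2]) (h3 : ¬ PermContainsPattern v ![2, 1, 3])
    (h5 : ¬ PermContainsPattern v ![3, 1, 2]) (h6 : ¬ PermContainsPattern v ![3, 2, 1]) :
    v = 1 ∨ v = finRotate (m + 1) := by
  -- a descent `x y` is forced to end at the last position
  have hdesc : ∀ x y : Fin (m + 1), x < y → (v y : ℕ) < v x → (y : ℕ) = m := by
    intro x y hxy hyx
    by_contra hne
    have hyl : y < Fin.last m := Fin.lt_def.mpr (by rw [Fin.val_last]; have := y.2; omega)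
    have := not213_vals h3 hxy hyl
    have := not312_vals h5 hxy hyl
    have := not321_vals h6 hxy hyl
    have := vals_ne v hyl.ne
    have := vals_ne v (hxy.trans hyl).ne
    omega
  by_cases hmono : StrictMono v
  · exact Or.inl (eq_one_of_strictMono hmono)
  right
  obtain ⟨x, y, hxy, hyx⟩ : ∃ x y : Fin (m + 1), x < y ∧ (v y : ℕ) < v x := by
    simp only [StrictMono, not_forall] at hmono
    obtain ⟨x, y, hxy, h⟩ := hmono
    refine ⟨x, y, hxy, ?_⟩
    have := vals_ne v hxy.ne
    rw [Fin.lt_def, not_lt] at h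
    omega
  have hyl : y = Fin.last m := Fin.ext (by rw [Fin.val_last]; exact hdesc x y hxy hyx)
  rw [hyl] at hxy hyx
  -- the last letter is the smallest
  have hmin : ∀ z : Fin (m + 1), z ≠ Fin.last m → (v (Fin.last m) : ℕ) < v z := by
    intro z hz
    have hzl : z < Fin.last m := lt_of_le_of_ne (Fin.le_last z) hz
    rcases lt_trichotomy z x with hzx | hzx | hzx
    · have := not132_vals h2 hzx hxy
      have := not321_vals h6 hzx hxy
      have := vals_ne v hzx.ne
      have := vals_ne v hzl.ne
      omega
    · rw [hzx]
      exact hyx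
    · have := not312_vals h5 hzx hzl
      have := not321_vals h6 hzx hzl
      have := vals_ne v hzx.ne
      have := vals_ne v hzl.ne
      omega
  -- every pair not ending at the last position ascends
  have hasc : ∀ s t : Fin (m + 1), s < t → t ≠ Fin.last m → (v s : ℕ) < v t := by
    intro s t hst ht
    have := vals_ne v hst.ne
    by_contra hle
    exact ht (Fin.ext (by rw [Fin.val_last]; exact hdesc s t hst (by omega)))
  -- `v ∘ finRotate⁻¹` increases, so `v = finRotate`
  have hrsymm : ∀ w : Fin (m + 1),
      (((finRotate (m + 1)).symm w : Fin (m + 1)) : ℕ) = if (w : ℕ) = 0 then m else (w : ℕ) - 1 := by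
    intro w
    have e := finRotate_val ((finRotate (m + 1)).symm w)
    rw [Equiv.apply_symm_apply] at e
    have := ((finRotate (m + 1)).symm w).2
    split_ifs at e
    all_goals split_ifs
    all_goals omega
  have key : StrictMono ⇑(v * (finRotate (m + 1)).symm : Perm (Fin (m + 1))) := by
    intro s t hst
    rw [Fin.lt_def]
    simp only [Perm.coe_mul, Function.comp_apply]
    have hst' := Fin.lt_def.mp hst
    have hs := hrsymm s
    have ht := hrsymm t
    have htl := t.2
    have ht0 : (t : ℕ) ≠ 0 := by omega
    rw [if_neg ht0] at ht
    have htne : (finRotate (m + 1)).symm t ≠ Fin.last m := fun e => by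
      have := congrArg Fin.val e
      rw [Fin.val_last, ht] at this
      omega
    by_cases hs0 : (s : ℕ) = 0
    · rw [if_pos hs0] at hs
      have e1 : (finRotate (m + 1)).symm s = Fin.last m := Fin.ext (by rw [hs, Fin.val_last])
      rw [e1]
      exact hmin _ htne
    · rw [if_neg hs0] at hs
      exact hasc _ _ (Fin.lt_def.mpr (by rw [hs, ht]; omega)) htne
  have := eq_one_of_strictMono key
  rw [show (finRotate (m + 1)).symm = (finRotate (m + 1))⁻¹ from rfl, mul_inv_eq_one] at this
  exact this

/-- The rotation `(2, 3, …, n, 1)` avoids `132, 213, 312, 321` (all its triples are `123` or `231`).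
[cite: SimionSchmidt1985, Proposition 17 (b), remark (held text p0015)] -/
theorem finRotate_av_four (m : ℕ) :
    ¬ PermContainsPattern (finRotate (m + 1)) ![1, 3, 2] ∧ ¬ PermContainsPattern (finRotate (m + 1)) ![2, 1, 3] ∧
      ¬ PermContainsPattern (finRotate (m + 1)) ![3, 1, 2] ∧ ¬ PermContainsPattern (finRotate (m + 1)) ![3, 2, 1] := by
  refine ⟨fun h => ?_, fun h => ?_, fun h => ?_, fun h => ?_⟩
  · obtain ⟨i, j, k, hij, hjk, h1, h2⟩ := (contains_132_iff _).mp h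
    rw [Fin.lt_def] at hij hjk h1 h2
    simp only [finRotate_val] at h1 h2
    have := k.2
    split_ifs at h1 h2 <;> omega
  · obtain ⟨i, j, k, hij, hjk, h1, h2⟩ := (contains_213_iff _).mp h
    rw [Fin.lt_def] at hij hjk h1 h2
    simp only [finRotate_val] at h1 h2
    have := k.2
    split_ifs at h1 h2 <;> omega
  · obtain ⟨i, j, k, hij, hjk, h1, h2⟩ := (contains_312_iff _).mp h
    rw [Fin.lt_def] at hij hjk h1 h2
    simp only [finRotate_val] at h1 h2
    have := k.2
    split_ifs at h1 h2 <;> omega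
  · obtain ⟨i, j, k, hij, hjk, h1, h2⟩ := (contains_321_iff _).mp h
    rw [Fin.lt_def] at hij hjk h1 h2
    simp only [finRotate_val] at h1 h2
    have := k.2
    split_ifs at h1 h2 <;> omega

/-- ★★ PROPOSITION 17 (b) for `R = {132, 213, 312, 321}` (omitted pair `{123, 231}`): `A_n(R) = 2` for `n ≥ 2`, the
avoiders being the identity and «`(2, 3, …, n, 1)`». [cite: SimionSchmidt1985, Proposition 17 (b) (held text p0015)] -/
theorem card_av132_av213_av312_av321 (hn : 2 ≤ n) :
    Nat.card {v : Perm (Fin n) // ¬ PermContainsPattern v ![1, 3, 2] ∧ ¬ PermContainsPattern v ![2, 1, 3] ∧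
      ¬ PermContainsPattern v ![3, 1, 2] ∧ ¬ PermContainsPattern v ![3, 2, 1]} = 2 := by
  obtain ⟨m, rfl⟩ : ∃ m, n = m + 1 := ⟨n - 1, by omega⟩
  refine natCard_eq_two 1 (finRotate (m + 1))
    ⟨not_contains_one_of_not_strictMono (by decide) _, not_contains_one_of_not_strictMono (by decide) _,
      not_contains_one_of_not_strictMono (by decide) _, not_contains_one_of_not_strictMono (by decide) _⟩
    (finRotate_av_four m) (fun h => ?_)
    fun v hv => eq_one_or_eq_finRotate_of_av_four hv.1 hv.2.1 hv.2.2.1 hv.2.2.2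
  have := congrArg (fun w : Perm (Fin (m + 1)) => ((w 0 : Fin (m + 1)) : ℕ)) h
  simp only [Perm.coe_one, id_eq, finRotate_val, Fin.val_zero] at this
  split_ifs at this
  all_goals omega

/-- PROPOSITION 17, summary of the values for `|R| = 4` up to reversal and complementation (`n ≥ 5`): `0` for the six
`R ⊇ {123, 321}`, `2` for the other nine (the three representatives). [cite: SimionSchmidt1985, Proposition 17 (held text p0015)] -/
theorem card_av_four_values (hn : 5 ≤ n) :
    Nat.card {v : Perm (Fin n) // ¬ PermContainsPattern v ![1, 2, 3] ∧ ¬ PermContainsPattern v ![3, 2, 1] ∧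
      ¬ PermContainsPattern v ![1, 3, 2] ∧ ¬ PermContainsPattern v ![2, 1, 3]} = 0 ∧
    Nat.card {v : Perm (Fin n) // ¬ PermContainsPattern v ![1, 3, 2] ∧ ¬ PermContainsPattern v ![2, 1, 3] ∧
      ¬ PermContainsPattern v ![2, 3, 1] ∧ ¬ PermContainsPattern v ![3, 1, 2]} = 2 ∧
    Nat.card {v : Perm (Fin n) // ¬ PermContainsPattern v ![2, 1, 3] ∧ ¬ PermContainsPattern v ![2, 3, 1] ∧
      ¬ PermContainsPattern v ![3, 1, 2] ∧ ¬ PermContainsPattern v ![3, 2, 1]} = 2 ∧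
    Nat.card {v : Perm (Fin n) // ¬ PermContainsPattern v ![1, 3, 2] ∧ ¬ PermContainsPattern v ![2, 1, 3] ∧
      ¬ PermContainsPattern v ![3, 1, 2] ∧ ¬ PermContainsPattern v ![3, 2, 1]} = 2 :=
  ⟨card_av123_av321_and_eq_zero _ hn, card_av132_av213_av231_av312 (by omega), card_av213_av231_av312_av321 (by omega),
    card_av132_av213_av312_av321 (by omega)⟩

end Prop17

/-! ### §3 PROPOSITION 17 (b) for the remaining six `R` (reversal and complementation) -/

section Prop17Symmetric

variable {m₁ m₂ m₃ m₄ : ℕ}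

/-- Reversal acts on quadruples of restrictions. [cite: SimionSchmidt1985, Lemma 1 and §5 (held text p0002, p0015)] -/
theorem card_av_quad_reverse (n : ℕ) (p : Fin m₁ → ℕ) (q : Fin m₂ → ℕ) (r : Fin m₃ → ℕ) (s : Fin m₄ → ℕ) :
    Nat.card {v : Perm (Fin n) // ¬ PermContainsPattern v p ∧ ¬ PermContainsPattern v q ∧ ¬ PermContainsPattern v r ∧
      ¬ PermContainsPattern v s} =
    Nat.card {v : Perm (Fin n) // ¬ PermContainsPattern v (p ∘ Fin.rev) ∧ ¬ PermContainsPattern v (q ∘ Fin.rev) ∧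
      ¬ PermContainsPattern v (r ∘ Fin.rev) ∧ ¬ PermContainsPattern v (s ∘ Fin.rev)} := by
  have hp : (p ∘ Fin.rev) ∘ Fin.rev = p := funext fun a => by simp
  have hq : (q ∘ Fin.rev) ∘ Fin.rev = q := funext fun a => by simp
  have hr : (r ∘ Fin.rev) ∘ Fin.rev = r := funext fun a => by simp
  have hs : (s ∘ Fin.rev) ∘ Fin.rev = s := funext fun a => by simp
  exact Nat.card_congr <| Equiv.subtypeEquiv (Equiv.mulRight Fin.revPerm) fun v => by
    rw [Equiv.coe_mulRight, reverse_iff, reverse_iff, reverse_iff, reverse_iff, hp, hq, hr, hs]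

/-- Complementation acts on quadruples of restrictions. [cite: SimionSchmidt1985, Lemma 1 and §5 (held text p0002, p0015)] -/
theorem card_av_quad_complement (n : ℕ) {p : Fin m₁ → ℕ} {q : Fin m₂ → ℕ} {r : Fin m₃ → ℕ} {s : Fin m₄ → ℕ}
    {M₁ M₂ M₃ M₄ : ℕ} (g₁ : ∀ a, p a ≤ M₁) (g₂ : ∀ a, q a ≤ M₂) (g₃ : ∀ a, r a ≤ M₃) (g₄ : ∀ a, s a ≤ M₄) :
    Nat.card {v : Perm (Fin n) // ¬ PermContainsPattern v p ∧ ¬ PermContainsPattern v q ∧ ¬ PermContainsPattern v r ∧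
      ¬ PermContainsPattern v s} =
    Nat.card {v : Perm (Fin n) // ¬ PermContainsPattern v (fun a => M₁ - p a) ∧
      ¬ PermContainsPattern v (fun a => M₂ - q a) ∧ ¬ PermContainsPattern v (fun a => M₃ - r a) ∧
        ¬ PermContainsPattern v (fun a => M₄ - s a)} := by
  have k₁ : ∀ a, M₁ - p a ≤ M₁ := fun a => Nat.sub_le M₁ (p a)
  have k₂ : ∀ a, M₂ - q a ≤ M₂ := fun a => Nat.sub_le M₂ (q a)
  have k₃ : ∀ a, M₃ - r a ≤ M₃ := fun a => Nat.sub_le M₃ (r a)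
  have k₄ : ∀ a, M₄ - s a ≤ M₄ := fun a => Nat.sub_le M₄ (s a)
  have e₁ : ∀ a b : Fin m₁, (M₁ - (M₁ - p a) < M₁ - (M₁ - p b) ↔ p a < p b) := fun a b => by
    have := g₁ a; have := g₁ b; constructor <;> intro <;> omega
  have e₂ : ∀ a b : Fin m₂, (M₂ - (M₂ - q a) < M₂ - (M₂ - q b) ↔ q a < q b) := fun a b => by
    have := g₂ a; have := g₂ b; constructor <;> intro <;> omega
  have e₃ : ∀ a b : Fin m₃, (M₃ - (M₃ - r a) < M₃ - (M₃ - r b) ↔ r a < r b) := fun a b => by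
    have := g₃ a; have := g₃ b; constructor <;> intro <;> omega
  have e₄ : ∀ a b : Fin m₄, (M₄ - (M₄ - s a) < M₄ - (M₄ - s b) ↔ s a < s b) := fun a b => by
    have := g₄ a; have := g₄ b; constructor <;> intro <;> omega
  refine Nat.card_congr <| Equiv.subtypeEquiv (Equiv.mulLeft Fin.revPerm) fun v => ?_
  rw [Equiv.coe_mulLeft, complement_iff _ k₁, complement_iff _ k₂, complement_iff _ k₃, complement_iff _ k₄,
    congr_pattern e₁ v, congr_pattern e₂ v, congr_pattern e₃ v, congr_pattern e₄ v]

/-- Bounds `≤ 4` on the letters, for complementation. [folklore] -/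
private theorem bd4 (x y z : ℕ) (hx : x ≤ 4) (hy : y ≤ 4) (hz : z ≤ 4) : ∀ a, (![x, y, z] : Fin 3 → ℕ) a ≤ 4 :=
  fun a => by fin_cases a <;> assumption

/-- PROPOSITION 17 (b), `R = {123, 132, 213, 312}` (omitted pair `{231, 321}`, the reversal of `{213, 231, 312, 321}`):
`A_n(R) = 2`, `n ≥ 2`. [cite: SimionSchmidt1985, Proposition 17 (b) (held text p0015)] -/
theorem card_av123_av132_av213_av312 (hn : 2 ≤ n) :
    Nat.card {v : Perm (Fin n) // ¬ PermContainsPattern v ![1, 2, 3] ∧ ¬ PermContainsPattern v ![1, 3, 2] ∧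
      ¬ PermContainsPattern v ![2, 1, 3] ∧ ¬ PermContainsPattern v ![3, 1, 2]} = 2 := by
  rw [card_av_quad_reverse, rev_123, rev_132, rev_213, rev_312]
  exact (Nat.card_congr (Equiv.subtypeEquivRight fun v => by tauto)).trans (card_av213_av231_av312_av321 hn)

/-- PROPOSITION 17 (b), `R = {123, 132, 213, 231}` (omitted `{312, 321}`, the complement of `{213, 231, 312, 321}`):
`A_n(R) = 2`, `n ≥ 2`. [cite: SimionSchmidt1985, Proposition 17 (b) (held text p0015)] -/
theorem card_av123_av132_av213_av231 (hn : 2 ≤ n) :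
    Nat.card {v : Perm (Fin n) // ¬ PermContainsPattern v ![1, 2, 3] ∧ ¬ PermContainsPattern v ![1, 3, 2] ∧
      ¬ PermContainsPattern v ![2, 1, 3] ∧ ¬ PermContainsPattern v ![2, 3, 1]} = 2 := by
  rw [card_av_quad_complement n (bd4 1 2 3 (by norm_num) (by norm_num) (by norm_num))
    (bd4 1 3 2 (by norm_num) (by norm_num) (by norm_num)) (bd4 2 1 3 (by norm_num) (by norm_num) (by norm_num))
    (bd4 2 3 1 (by norm_num) (by norm_num) (by norm_num)), compl_123, compl_132, compl_213, compl_231]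
  exact (Nat.card_congr (Equiv.subtypeEquivRight fun v => by tauto)).trans (card_av213_av231_av312_av321 hn)

/-- PROPOSITION 17 (b), `R = {132, 231, 312, 321}` (omitted `{123, 213}`, the reverse-complement of
`{213, 231, 312, 321}`): `A_n(R) = 2`, `n ≥ 2`. [cite: SimionSchmidt1985, Proposition 17 (b) (held text p0015)] -/
theorem card_av132_av231_av312_av321 (hn : 2 ≤ n) :
    Nat.card {v : Perm (Fin n) // ¬ PermContainsPattern v ![1, 3, 2] ∧ ¬ PermContainsPattern v ![2, 3, 1] ∧
      ¬ PermContainsPattern v ![3, 1, 2] ∧ ¬ PermContainsPattern v ![3, 2, 1]} = 2 := by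
  rw [card_av_quad_reverse, rev_132, rev_231, rev_312, rev_321]
  exact (Nat.card_congr (Equiv.subtypeEquivRight fun v => by tauto)).trans (card_av123_av132_av213_av231 hn)

/-- PROPOSITION 17 (b), `R = {123, 213, 231, 312}` (omitted `{132, 321}`, the reversal of `{132, 213, 312, 321}`):
`A_n(R) = 2`, `n ≥ 2`. [cite: SimionSchmidt1985, Proposition 17 (b) (held text p0015)] -/
theorem card_av123_av213_av231_av312 (hn : 2 ≤ n) :
    Nat.card {v : Perm (Fin n) // ¬ PermContainsPattern v ![1, 2, 3] ∧ ¬ PermContainsPattern v ![2, 1, 3] ∧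
      ¬ PermContainsPattern v ![2, 3, 1] ∧ ¬ PermContainsPattern v ![3, 1, 2]} = 2 := by
  rw [card_av_quad_reverse, rev_123, rev_213, rev_231, rev_312]
  exact (Nat.card_congr (Equiv.subtypeEquivRight fun v => by tauto)).trans (card_av132_av213_av312_av321 hn)

/-- PROPOSITION 17 (b), `R = {123, 132, 231, 312}` (omitted `{213, 321}`, the complement of `{132, 213, 312, 321}`):
`A_n(R) = 2`, `n ≥ 2`. [cite: SimionSchmidt1985, Proposition 17 (b) (held text p0015)] -/
theorem card_av123_av132_av231_av312 (hn : 2 ≤ n) :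
    Nat.card {v : Perm (Fin n) // ¬ PermContainsPattern v ![1, 2, 3] ∧ ¬ PermContainsPattern v ![1, 3, 2] ∧
      ¬ PermContainsPattern v ![2, 3, 1] ∧ ¬ PermContainsPattern v ![3, 1, 2]} = 2 := by
  rw [card_av_quad_complement n (bd4 1 2 3 (by norm_num) (by norm_num) (by norm_num))
    (bd4 1 3 2 (by norm_num) (by norm_num) (by norm_num)) (bd4 2 3 1 (by norm_num) (by norm_num) (by norm_num))
    (bd4 3 1 2 (by norm_num) (by norm_num) (by norm_num)), compl_123, compl_132, compl_231, compl_312]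
  exact (Nat.card_congr (Equiv.subtypeEquivRight fun v => by tauto)).trans (card_av132_av213_av312_av321 hn)

/-- PROPOSITION 17 (b), `R = {132, 213, 231, 321}` (omitted `{123, 312}`, the reverse-complement of
`{132, 213, 312, 321}`): `A_n(R) = 2`, `n ≥ 2`. [cite: SimionSchmidt1985, Proposition 17 (b) (held text p0015)] -/
theorem card_av132_av213_av231_av321 (hn : 2 ≤ n) :
    Nat.card {v : Perm (Fin n) // ¬ PermContainsPattern v ![1, 3, 2] ∧ ¬ PermContainsPattern v ![2, 1, 3] ∧
      ¬ PermContainsPattern v ![2, 3, 1] ∧ ¬ PermContainsPattern v ![3, 2, 1]} = 2 := by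
  rw [card_av_quad_reverse, rev_132, rev_213, rev_231, rev_321]
  exact (Nat.card_congr (Equiv.subtypeEquivRight fun v => by tauto)).trans (card_av123_av132_av231_av312 hn)

end Prop17Symmetric

end PermContainsPattern

end Literature.Combinatorics.Enumerative
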